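import Mathlib.RingTheory.Trace.Basic
import Mathlib.LinearAlgebra.BilinearForm.Properties
import Mathlib.LinearAlgebra.BilinearForm.TensorProduct
import Mathlib.NumberTheory.NumberField.InfinitePlace.Embeddings
import Mathlib.Algebra.Algebra.Hom.Rat
import HarnessLib

/-!
# COR-CM model facts, exterior-algebra group: the trace-dual basis of a number field and RATIONAL
# "diagonal" pairings (tool for model axiom M15 `Fact_weilLine_rank`)

HONEST FRAMING (cell pub-hodgecm2 / COR-CM): pure algebra of number fields; nothing about algebraic
cycles.

To produce RATIONAL Weil classes on the corner product `P = A₀ × A₁ × A₂ × A₃` (classes in `H⁴(P, ℚ)`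
whose complexification lies in the span of the `σ`-isotypic generators
`g_σ = v_{0σ} ∪ v_{1σ} ∪ v_{2σ} ∪ v_{3σ}`), one pairs rational classes of two factors through the
TRACE-DUAL basis of `K/ℚ`: if `b` is a `ℚ`-basis of `K` and `b^∨` its dual basis for the trace form
`(x, y) ↦ Tr_{K/ℚ}(xy)` (non-degenerate: `K/ℚ` is separable), then for all embeddings `σ, τ : K → ℂ`

  `Σᵢ σ(bᵢ) · τ(b^∨ᵢ) = δ_{στ}`      (`sum_embedding_mul_embedding_dual`)

— the components of the separability idempotent `Σᵢ bᵢ ⊗ b^∨ᵢ ∈ K ⊗_ℚ K`; proof: for every `z ∈ K`,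
`Σ_σ (Σᵢ σ(bᵢ) τ(b^∨ᵢ)) σ(z) = Σᵢ τ(b^∨ᵢ) Tr(bᵢ z) = τ(Σᵢ Tr(z bᵢ) b^∨ᵢ) = τ(z)` (trace = sum of the
embeddings; dual-basis expansion), and the embeddings are `ℂ`-linearly independent as functions on `K`
(Dedekind / Artin, Mathlib `linearIndependent_monoidHom`). Consequently (`one_tmul_sum_pairing_dual`): if
`x, y : K → V₁` are `ℚ`-linear maps whose complexifications are DIAGONAL in families
`X_σ`, `Y_σ` — `1 ⊗ x(e) = Σ_σ σ(e) α_σ X_σ`, `1 ⊗ y(e) = Σ_σ σ(e) β_σ Y_σ` — then for every `ℚ`-bilinear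
`B : V₁ × V₁ → V₃` the RATIONAL vector `Σᵢ B(x(e bᵢ), y(b^∨ᵢ))` is again diagonal:
`1 ⊗ Σᵢ B(x(e bᵢ), y(b^∨ᵢ)) = Σ_σ σ(e) α_σ β_σ · B_ℂ(X_σ, Y_σ)` (the cross terms `σ ≠ τ` cancel).

## References
* [Deligne1982HodgeCycles] P. Deligne, LNM 900 (1982), §4 (the `E ⊗ ℂ = ℂ^{Hom(E,ℂ)}` bookkeeping).
* [Shimura1998] G. Shimura, *Abelian Varieties with Complex Multiplication and Modular Functions*
  (1998), §3.2.
-/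

noncomputable section

open scoped TensorProduct
open Module

namespace Summit.HodgeConjecture.CorCM.Model

section TraceDual

variable {K : Type} [Field K] [NumberField K]

/-- A ring homomorphism `K → ℂ` of a number field is `ℚ`-linear: `τ (q • k) = q • τ k`. [folklore] -/
theorem embedding_map_rat_smul (τ : K →+* ℂ) (q : ℚ) (k : K) : τ (q • k) = (q : ℂ) * τ k := by
  rw [Rat.smul_def, map_mul, map_ratCast]

/-- The trace of a number field is the sum of its complex embeddings (ring-hom indexing):
`Tr_{K/ℚ}(x) = Σ_{σ : K →+* ℂ} σ(x)`. [folklore] -/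
theorem trace_eq_sum_ringHom (x : K) :
    ((Algebra.trace ℚ K x : ℚ) : ℂ) = ∑ σ : K →+* ℂ, σ x := by
  have h := trace_eq_sum_embeddings ℂ (K := ℚ) (L := K) (x := x)
  rw [eq_ratCast] at h
  rw [h]
  exact (Fintype.sum_equiv RingHom.equivRatAlgHom (fun σ : K →+* ℂ ↦ σ x)
    (fun σ : K →ₐ[ℚ] ℂ ↦ σ x) (fun σ ↦ rfl)).symm

/-- **Dedekind independence, coefficient form**: if `Σ_σ c_σ σ(z) = 0` for all `z ∈ K` then all
`c_σ = 0` (the embeddings `K → ℂ` are linearly independent functions). [folklore] -/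
theorem eq_zero_of_sum_embedding_mul_eq_zero (c : (K →+* ℂ) → ℂ)
    (h : ∀ z : K, ∑ σ : K →+* ℂ, c σ * σ z = 0) (σ : K →+* ℂ) : c σ = 0 := by
  have hli : LinearIndependent ℂ (fun σ : K →+* ℂ ↦ ((σ : K →* ℂ) : K → ℂ)) :=
    (linearIndependent_monoidHom K ℂ).comp (fun σ : K →+* ℂ ↦ (σ : K →* ℂ))
      RingHom.coe_monoidHom_injective
  have hsum : ∑ τ : K →+* ℂ, c τ • ((τ : K →* ℂ) : K → ℂ) = 0 := by
    funext z
    rw [Finset.sum_apply, Pi.zero_apply, ← h z]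
    refine Finset.sum_congr rfl fun τ _ ↦ ?_
    rfl
  exact Fintype.linearIndependent_iff.1 hli c hsum σ

variable {ι : Type*} [Fintype ι] [DecidableEq ι]

open scoped Classical in
/-- **The separability idempotent in coordinates.** For a `ℚ`-basis `b` of the number field `K` and its
dual basis `b^∨` for the trace form, `Σᵢ σ(bᵢ) τ(b^∨ᵢ) = δ_{στ}` for all embeddings `σ, τ : K → ℂ`.
[folklore] -/
theorem sum_embedding_mul_embedding_dual (b : Basis ι ℚ K) (σ τ : K →+* ℂ) :
    ∑ i, σ (b i) * τ ((Algebra.traceForm ℚ K).dualBasis (traceForm_nondegenerate ℚ K) b i) =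
      if σ = τ then 1 else 0 := by
  classical
  set d := (Algebra.traceForm ℚ K).dualBasis (traceForm_nondegenerate ℚ K) b with hd
  -- the coefficients `c σ' := Σᵢ σ'(bᵢ) τ(dᵢ) - δ_{σ'τ}` pair to zero against every `σ'(z)`
  have key : ∀ z : K, ∑ σ' : K →+* ℂ, ((∑ i, σ' (b i) * τ (d i)) - if σ' = τ then 1 else 0) * σ' z = 0 := by
    intro z
    have hexp : ∑ i, (Algebra.trace ℚ K (z * b i)) • d i = z := by
      conv_rhs => rw [← d.sum_repr z]
      refine Finset.sum_congr rfl fun i _ ↦ ?_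
      rw [hd, LinearMap.BilinForm.dualBasis_repr_apply, Algebra.traceForm_apply]
    have h1 : ∑ σ' : K →+* ℂ, (∑ i, σ' (b i) * τ (d i)) * σ' z = τ z := by
      calc ∑ σ' : K →+* ℂ, (∑ i, σ' (b i) * τ (d i)) * σ' z
          = ∑ i, τ (d i) * ∑ σ' : K →+* ℂ, σ' (b i * z) := by
            simp_rw [Finset.sum_mul, map_mul, Finset.mul_sum]
            rw [Finset.sum_comm]
            refine Finset.sum_congr rfl fun i _ ↦ Finset.sum_congr rfl fun σ' _ ↦ ?_
            ring
        _ = ∑ i, τ (d i) * ((Algebra.trace ℚ K (b i * z) : ℚ) : ℂ) := by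
            simp_rw [trace_eq_sum_ringHom]
        _ = τ (∑ i, (Algebra.trace ℚ K (z * b i)) • d i) := by
            rw [map_sum]
            refine Finset.sum_congr rfl fun i _ ↦ ?_
            rw [embedding_map_rat_smul, mul_comm (b i) z, mul_comm]
        _ = τ z := by rw [hexp]
    have h2 : ∑ σ' : K →+* ℂ, (if σ' = τ then (1 : ℂ) else 0) * σ' z = τ z := by
      simp [Finset.sum_ite_eq', Finset.mem_univ]
    simp_rw [sub_mul, Finset.sum_sub_distrib, h1, h2, sub_self]
  have := eq_zero_of_sum_embedding_mul_eq_zero _ key σ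
  exact sub_eq_zero.1 this

end TraceDual

section Pairing

variable {K : Type} [Field K] [NumberField K]
variable {V₁ V₃ : Type*} [AddCommGroup V₁] [Module ℚ V₁] [AddCommGroup V₃] [Module ℚ V₃]

open scoped Classical in
/-- **Diagonal pairing through the trace-dual basis.** Let `x, y : K → V₁` be `ℚ`-linear
with DIAGONAL complexifications `1 ⊗ x(e) = Σ_σ σ(e) α_σ • X_σ`, `1 ⊗ y(e) = Σ_σ σ(e) β_σ • Y_σ`, and
`B : V₁ × V₁ → V₃` a `ℚ`-bilinear map (`LinearMap.BilinMap`). Then for a `ℚ`-basis `b` of `K` with a "dual" family `d`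
(`Σᵢ σ(bᵢ) τ(dᵢ) = δ_{στ}`) and every `e ∈ K`:
`1 ⊗ Σᵢ B(x(e bᵢ), y(dᵢ)) = Σ_σ σ(e) α_σ β_σ • B_ℂ(X_σ, Y_σ)`. [folklore] -/
theorem one_tmul_sum_pairing_dual {ι : Type*} [Fintype ι] (b d : ι → K)
    (hbd : ∀ σ τ : K →+* ℂ, ∑ i, σ (b i) * τ (d i) = if σ = τ then 1 else 0)
    (B : LinearMap.BilinMap ℚ V₁ V₃) (x y : K →ₗ[ℚ] V₁)
    (X Y : (K →+* ℂ) → ℂ ⊗[ℚ] V₁) (α β : (K →+* ℂ) → ℂ)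
    (hx : ∀ e, (1 : ℂ) ⊗ₜ[ℚ] x e = ∑ σ : K →+* ℂ, (σ e * α σ) • X σ)
    (hy : ∀ e, (1 : ℂ) ⊗ₜ[ℚ] y e = ∑ σ : K →+* ℂ, (σ e * β σ) • Y σ) (e : K) :
    (1 : ℂ) ⊗ₜ[ℚ] (∑ i, B (x (e * b i)) (y (d i))) =
      ∑ σ : K →+* ℂ, (σ e * (α σ * β σ)) • (LinearMap.BilinMap.baseChange ℂ B) (X σ) (Y σ) := by
  classical
  -- complexify term by term
  have hterm : ∀ i, (1 : ℂ) ⊗ₜ[ℚ] B (x (e * b i)) (y (d i)) =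
      ∑ σ : K →+* ℂ, ∑ τ : K →+* ℂ,
        ((σ e * α σ) * (τ (d i) * β τ) * σ (b i)) • (LinearMap.BilinMap.baseChange ℂ B) (X σ) (Y τ) := by
    intro i
    have h := LinearMap.BilinMap.baseChange_tmul (A := ℂ) B (1 : ℂ) (x (e * b i)) (1 : ℂ) (y (d i))
    rw [one_mul] at h
    rw [← h, hx, hy, LinearMap.map_sum₂]
    refine Finset.sum_congr rfl fun σ _ ↦ ?_
    rw [LinearMap.map_smul₂, map_sum, Finset.smul_sum]
    refine Finset.sum_congr rfl fun τ _ ↦ ?_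
    rw [map_smul, smul_smul, map_mul]
    congr 1
    ring
  rw [TensorProduct.tmul_sum]
  simp_rw [hterm]
  rw [Finset.sum_comm]
  refine Finset.sum_congr rfl fun σ _ ↦ ?_
  rw [Finset.sum_comm]
  -- the inner sum over `i` produces `δ_{στ}`
  have hinner : ∀ τ : K →+* ℂ,
      ∑ i, ((σ e * α σ) * (τ (d i) * β τ) * σ (b i)) • (LinearMap.BilinMap.baseChange ℂ B) (X σ) (Y τ) =
      ((σ e * α σ * β τ) * (if σ = τ then 1 else 0)) • (LinearMap.BilinMap.baseChange ℂ B) (X σ) (Y τ) := by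
    intro τ
    rw [← Finset.sum_smul, ← hbd σ τ, Finset.mul_sum]
    congr 1
    refine Finset.sum_congr rfl fun i _ ↦ ?_
    ring
  simp_rw [hinner]
  rw [Finset.sum_eq_single σ]
  · simp [mul_assoc]
  · intro τ _ hτ
    rw [if_neg (Ne.symm hτ), mul_zero, zero_smul]
  · intro h
    exact absurd (Finset.mem_univ σ) h

end Pairing

end Summit.HodgeConjecture.CorCM.Model

end
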